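/-
Copyright (c) 2026 the pub-hodgecm-mathlib formalisation cell (harness21).  Prover seat hodgecm-mathlib-LH4-p12 (g4), Track A «(D-RAM) FOUR-FRAME», unit U2H, leaf (ρ2b′-X),
RHO2BX-ORDER v1 organ O-Cone — the VALUE DICTIONARY of a valued field embedding `jE : E →+* M` with `|jE x| = |x|^e`.  2026-09-04.
-/
import Literature.NumberTheory.Rogawski1990.TypeTwoEisensteinData   -- ★ `exists_v_eq_exp_neg_nat` (`0 < |x| ≤ 1 ⇒ |x| = exp(−k)`)
import HarnessLib

/-!
# The value dictionary of an embedding of discretely valued fields with `|jE x| = |x|^e`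

For fields `E`, `M` valued in `ℤᵐ⁰` and a ring map `jE : E →+* M` whose values are `e`-th powers, `|jE x| = |x|^e` (`e ≠ 0`; `e = 1`: an unramified ∕ value-preserving embedding,
`e = 2`: a ramified quadratic one — ★ `valued_toPlace_eq_sq_of_ramified`), together with a uniformiser `ϖ` of `E` (`|ϖ| = exp(−1)`), the four clauses used as BINDERS by the
line-model census files of crux H413 (★ `EllipticPlaneAsFieldLine*`, ★ `F0P3cDyRamWSideOrderCensus`, ★ `F0P3cDyRamConeLevelTransport{Out,In}`, ★ `F0P3cDyRamConeLevelCensus`):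
* `v_map_le_one_iff` — **hjv** `|jE c| ≤ 1 ⟺ |c| ≤ 1`;
* `v_map_eq_zpow_iff` — **hjpow** `|jE t| = |jE ϖ|^n ⟺ |t| = |ϖ|^n` (`n : ℤ`);
* `exists_v_eq_pow_of_fixed` — **hEval**: an element of the image (`ρ c = c ⟺ c ∈ jE(E)` for the involution `ρ` of `M∕E`) with `0 < |c| ≤ 1` has `|c| = |jE ϖ|^n`, `n : ℕ`;
* `v_le_map_of_fixed_of_lt_one` — **hϖmax**: an element of the image with `|t| < 1` has `|t| ≤ |jE ϖ|`.
Pure valuation arithmetic (discreteness of `ℤᵐ⁰` + injectivity of `x ↦ x^e`). [Serre1979, Ch. II §2–§3] (e, f of an extension of discretely valued fields; `v_M ∘ jE = e·v_E`).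

## References
* [Serre1979] J.-P. Serre, *Local Fields*, GTM 67, Springer 1979, Ch. II §§2–3 (ramification index; extension of a discrete valuation), Ch. I §7.
-/

set_option autoImplicit false

noncomputable section

open scoped Valued WithZero
open WithZero
open Literature.NumberTheory.Rogawski1990 (exists_v_eq_exp_neg_nat)

namespace Literature.NumberTheory.LocalFields.ValuedEmbedding

variable {E M : Type*} [Field E] [Valued E ℤᵐ⁰] [Field M] [Valued M ℤᵐ⁰]

/-- **hjv**: `|jE c| ≤ 1 ⟺ |c| ≤ 1` when `|jE x| = |x|^e`, `e ≠ 0`. [cite: Serre1979, Ch. II §2] -/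
theorem v_map_le_one_iff (jE : E →+* M) {e : ℕ} (he : e ≠ 0) (hje : ∀ x, Valued.v (jE x) = Valued.v x ^ e) (c : E) :
    Valued.v (jE c) ≤ 1 ↔ Valued.v c ≤ 1 := by
  rw [hje]
  refine ⟨fun h => ?_, fun h => pow_le_one₀ zero_le h⟩
  by_contra hc
  push Not at hc
  have hlt := pow_lt_pow_left₀ hc zero_le he
  rw [one_pow] at hlt
  exact not_le_of_gt hlt h

/-- `|jE c| < 1 ⟺ |c| < 1`. [cite: Serre1979, Ch. II §2] -/
theorem v_map_lt_one_iff (jE : E →+* M) {e : ℕ} (he : e ≠ 0) (hje : ∀ x, Valued.v (jE x) = Valued.v x ^ e) (c : E) :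
    Valued.v (jE c) < 1 ↔ Valued.v c < 1 := by
  rw [hje]
  refine ⟨fun h => ?_, fun h => pow_lt_one₀ zero_le h he⟩
  by_contra hc
  push Not at hc
  exact not_lt_of_ge (one_le_pow₀ hc) h

/-- **hjpow**: `|jE t| = |jE ϖ|^n ⟺ |t| = |ϖ|^n` (`n : ℤ`) when `|jE x| = |x|^e`, `e ≠ 0` (`x ↦ x^e` is injective on `ℤᵐ⁰`). [cite: Serre1979, Ch. II §2] -/
theorem v_map_eq_zpow_iff (jE : E →+* M) {e : ℕ} (he : e ≠ 0) (hje : ∀ x, Valued.v (jE x) = Valued.v x ^ e) (ϖ t : E) (n : ℤ) :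
    Valued.v (jE t) = Valued.v (jE ϖ) ^ n ↔ Valued.v t = Valued.v ϖ ^ n := by
  have hswap : (Valued.v ϖ ^ e) ^ n = (Valued.v ϖ ^ n) ^ e := by
    rw [← zpow_natCast, ← zpow_natCast, ← zpow_mul, ← zpow_mul, mul_comm]
  rw [hje, hje, hswap]
  exact pow_left_inj₀ zero_le zero_le he

/-- A uniformiser's powers exhaust the integral values: `0 < |x| ≤ 1 ⇒ |x| = |ϖ|^k` (`k : ℕ`) for `|ϖ| = exp(−1)`. [cite: Serre1979, Ch. I §7; Ch. II §2] -/
theorem exists_v_eq_uniformizer_pow {ϖ : E} (hϖ : Valued.v ϖ = exp (-1 : ℤ)) {x : E} (hx : x ≠ 0) (hx1 : Valued.v x ≤ 1) :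
    ∃ k : ℕ, Valued.v x = Valued.v ϖ ^ k := by
  obtain ⟨k, hk⟩ := exists_v_eq_exp_neg_nat hx hx1
  refine ⟨k, ?_⟩
  rw [hk, hϖ, ← exp_nsmul]
  simp

/-- Discreteness below `1`: `|x| < 1 ⇒ |x| ≤ |ϖ|` for a uniformiser `ϖ` (`|ϖ| = exp(−1)`). [cite: Serre1979, Ch. I §7] -/
theorem v_le_uniformizer_of_lt_one {ϖ : E} (hϖ : Valued.v ϖ = exp (-1 : ℤ)) {x : E} (hx1 : Valued.v x < 1) : Valued.v x ≤ Valued.v ϖ := by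
  by_cases hx : x = 0
  · rw [hx, map_zero]; exact zero_le
  obtain ⟨k, hk⟩ := exists_v_eq_exp_neg_nat hx hx1.le
  have hk1 : 1 ≤ k := by
    by_contra hk0
    have : k = 0 := by omega
    rw [this, Nat.cast_zero, neg_zero, exp_zero] at hk
    exact hx1.ne hk
  rw [hk, hϖ]
  exact exp_le_exp.2 (by omega)

/-- **hEval**: an element `c` of the image of `jE` (spelled through an involution `ρ` with `ρ c = c ⟺ c ∈ jE(E)`) with `c ≠ 0`, `|c| ≤ 1` has `|c| = |jE ϖ|^n` for some `n : ℕ`.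
[cite: Serre1979, Ch. II §2] -/
theorem exists_v_eq_pow_of_fixed (jE : E →+* M) {e : ℕ} (he : e ≠ 0) (hje : ∀ x, Valued.v (jE x) = Valued.v x ^ e) {ϖ : E} (hϖ : Valued.v ϖ = exp (-1 : ℤ))
    {ρ : M →+* M} (hjfix : ∀ z, ρ z = z ↔ ∃ c, jE c = z) (c : M) (hc : ρ c = c) (hc0 : c ≠ 0) (hc1 : Valued.v c ≤ 1) :
    ∃ n : ℕ, Valued.v c = Valued.v (jE ϖ) ^ n := by
  obtain ⟨t, rfl⟩ := (hjfix c).1 hc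
  have ht0 : t ≠ 0 := fun h0 => hc0 (by rw [h0, map_zero])
  obtain ⟨k, hk⟩ := exists_v_eq_uniformizer_pow hϖ ht0 ((v_map_le_one_iff jE he hje t).1 hc1)
  exact ⟨k, by rw [hje, hje, hk, ← pow_mul, ← pow_mul, mul_comm]⟩

/-- **hϖmax**: an element `t` of the image of `jE` with `|t| < 1` has `|t| ≤ |jE ϖ|` — `|jE ϖ|` is the largest image value below `1`. [cite: Serre1979, Ch. II §2] -/
theorem v_le_map_of_fixed_of_lt_one (jE : E →+* M) {e : ℕ} (he : e ≠ 0) (hje : ∀ x, Valued.v (jE x) = Valued.v x ^ e) {ϖ : E} (hϖ : Valued.v ϖ = exp (-1 : ℤ))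
    {ρ : M →+* M} (hjfix : ∀ z, ρ z = z ↔ ∃ c, jE c = z) (t : M) (ht : ρ t = t) (ht1 : Valued.v t < 1) : Valued.v t ≤ Valued.v (jE ϖ) := by
  obtain ⟨s, rfl⟩ := (hjfix t).1 ht
  have hs1 : Valued.v s < 1 := (v_map_lt_one_iff jE he hje s).1 ht1
  rw [hje, hje]
  exact pow_le_pow_left₀ zero_le (v_le_uniformizer_of_lt_one hϖ hs1) e

/-- The image uniformiser: `jE ϖ ≠ 0` and `|jE ϖ| = exp(−e) < 1`. [cite: Serre1979, Ch. II §2] -/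
theorem v_map_uniformizer_eq (jE : E →+* M) {e : ℕ} (hje : ∀ x, Valued.v (jE x) = Valued.v x ^ e) {ϖ : E} (hϖ : Valued.v ϖ = exp (-1 : ℤ)) :
    Valued.v (jE ϖ) = exp (-(e : ℤ)) := by
  rw [hje, hϖ, ← exp_nsmul]
  simp

/-- `|jE ϖ| < 1` (`e ≠ 0`). [cite: Serre1979, Ch. II §2] -/
theorem v_map_uniformizer_lt_one (jE : E →+* M) {e : ℕ} (he : e ≠ 0) (hje : ∀ x, Valued.v (jE x) = Valued.v x ^ e) {ϖ : E} (hϖ : Valued.v ϖ = exp (-1 : ℤ)) :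
    Valued.v (jE ϖ) < 1 := by
  rw [v_map_uniformizer_eq jE hje hϖ, ← exp_zero, exp_lt_exp]
  omega

end Literature.NumberTheory.LocalFields.ValuedEmbedding

end
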